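import Mathlib
import Summits.AtomisticToContinuum.BoseEinsteinCondensation.Theses.BECHardSphereReduction

/-!
# Crux-strategist census sketch for `HardSphereBEC` (stmt-AtomisticToContinuum-11885)

Typed versions of the statements quoted in `STRATEGY-CENSUS.md` (Strengthen / Decomposition
headings). Nothing here is filed as an item or registered as a line; the file only certifies that
the signatures discussed in the census elaborate over the tree's declarations.
-/

noncomputable section

namespace Summit.AtomisticToContinuum.BoseEinsteinCondensation.Cruxes.HardSphereBEC.StrategistCensus

open Filter MeasureTheory
open scoped ENNReal
open Literature.MathematicalPhysics.QuantumManyBody.BoseGas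

/-- The unit hard-sphere pair potential `v = ⊤·1_{r ≤ 1}` (scattering length `a = 1`). -/
def HS₁ : ℝ → ℝ≥0∞ := Set.indicator (Set.Iic 1) (fun _ : ℝ => (⊤ : ℝ≥0∞))

/-- The crux, by name. -/
abbrev Crux : Prop :=
  Summit.AtomisticToContinuum.BoseEinsteinCondensation.Theses.BECHardSphereReduction.HardSphereBEC

/-! ## Strengthen -/

/-- **S⁺_g (uniform Bogoliubov-degree depletion).** For unit hard spheres the depletion
`N − cn(N, L)` is at most `C (N/L)^{3/2} + C` uniformly in `(N, L)` in the dilute region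
`N ≤ η₀ L³` (GP parameter `g = N a / L`; Bogoliubov predicts depletion `(8/3√π) g^{3/2}`).
At `L = (N/η)^{1/3}` this reads `cn ≥ N (1 − C √η) − C`, hence the crux for `η < 1/(16 C²)`. -/
def UniformDepletionHS : Prop :=
  ∃ C η₀ : ℝ, 0 < C ∧ 0 < η₀ ∧ ∀ N : ℕ, ∀ L : ℝ, 0 < L → (N : ℝ) ≤ η₀ * L ^ 3 →
    ENNReal.ofReal ((N : ℝ) - C * ((N : ℝ) / L) ^ (3 / 2 : ℝ) - C) ≤ condensateNumber HS₁ N L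

/-- **S⁺_KL (small conditional entropy, entropy form of the stuck stub).** For non-negative
`δ`-near-minimisers of the unit hard-sphere gas in the thermodynamic box, the conditional relative
entropy `E_Y KL(p(·|Y) ‖ u_Λ)` of one sphere given the others is `≤ ε` with `e^{-ε} > 1/2`
(the integrand is the one of `BECCellInformation.CondEntropyBound`, specialised to `v := HS₁`). By
Rényi-½ ≤ KL and Jensen this gives flat-mode fraction `≥ e^{-ε} > 1/2`, i.e. the lead's
`stub_majorityPositiveZeroMode`. -/
def SmallCondEntropyHS : Prop :=
  ∃ ε : ℝ, 0 < ε ∧ 1 / 2 < Real.exp (-ε) ∧ ∃ η₁ : ℝ, 0 < η₁ ∧ ∀ η : ℝ, 0 < η → η < η₁ →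
    ∀ᶠ n : ℕ in atTop, ∃ δ : ℝ≥0∞, 0 < δ ∧ ∀ Ψ : TrialState (n + 1) (sideLength η (n + 1)),
      energy HS₁ Ψ ≤ groundStateEnergy HS₁ (n + 1) (sideLength η (n + 1)) + δ →
      (∀ X, Ψ.ψ X = (‖Ψ.ψ X‖ : ℂ)) →
      ∫⁻ Y : Config n, ∫⁻ x in box (sideLength η (n + 1)),
        ENNReal.ofReal ((∫ z, ‖Ψ.ψ (Matrix.vecCons z Y)‖ ^ 2) / sideLength η (n + 1) ^ 3 *
          InformationTheory.klFun (sideLength η (n + 1) ^ 3 * ‖Ψ.ψ (Matrix.vecCons x Y)‖ ^ 2 /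
            ∫ z, ‖Ψ.ψ (Matrix.vecCons z Y)‖ ^ 2)) ≤ ENNReal.ofReal ε

/-- **S⁺_rate (thermodynamic fraction with Bogoliubov rate).** -/
def RateFormHS : Prop :=
  ∃ C η₁ : ℝ, 0 < C ∧ 0 < η₁ ∧ ∀ η : ℝ, 0 < η → η < η₁ → ∀ᶠ N : ℕ in atTop,
    ENNReal.ofReal ((1 - C * Real.sqrt η) * N) ≤ condensateNumber HS₁ N (sideLength η N)

/-! ## Decomposition (anchor + propagation in particle number at fixed density) -/

/-- **D₁ (anchor window).** For every loss constant `C` and all small `η` there is a window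
`[M, 2M)` of particle numbers, with `C · M^{-1/4} ≤ 1/20`, on which the condensate fraction of the
unit hard-sphere gas at density `η` is at least `9/10`. (Few-body, ultra-dilute: `g = N/L → 0`;
provable now by vanishing-capacity domain perturbation.) -/
def AnchorWindowHS : Prop :=
  ∀ C : ℝ, 0 < C → ∃ η₁ : ℝ, 0 < η₁ ∧ ∀ η : ℝ, 0 < η → η < η₁ → ∃ M : ℕ, 2 ≤ M ∧
    C * (M : ℝ) ^ (-(1 / 4 : ℝ)) ≤ 1 / 20 ∧
    ∀ N : ℕ, M ≤ N → N < 2 * M →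
      ENNReal.ofReal ((9 / 10 : ℝ) * N) ≤ condensateNumber HS₁ N (sideLength η N)

/-- **D₂ (ratio-two retention of the condensate fraction at fixed density).** Going from `N` to any
`N' ∈ [N, 2N]` particles at the same density `η` loses at most `C N^{-1/4}` of condensate FRACTION.
(Physically: finite-size corrections `f_N − f_∞ = O(N^{-1/3})`; summable along ratio-2 chains.) -/
def RatioTwoRetentionHS : Prop :=
  ∃ C : ℝ, 0 < C ∧ ∃ η₁ : ℝ, 0 < η₁ ∧ ∀ η : ℝ, 0 < η → η < η₁ → ∀ N N' : ℕ, 1 ≤ N → N ≤ N' →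
    N' ≤ 2 * N →
      condensateNumber HS₁ N (sideLength η N) / (N : ℝ≥0∞) ≤
        condensateNumber HS₁ N' (sideLength η N') / (N' : ℝ≥0∞) +
          ENNReal.ofReal (C * (N : ℝ) ^ (-(1 / 4 : ℝ)))

/-! ## Negation (the typed obstruction one would need) -/

/-- **N₁ (screening at the healing scale — the route's own dead quenched bet, SLICE-PROGRAM §4):**
an `L`-independent oscillation bound for `log` of the slices of non-negative near-minimisers on the
bulk of typical environments. Stated here only through its consequence on slice affinities
(`(∫ u_Y)² ≥ θ L³ ∫ u_Y²` for a `Y`-set of mass `≥ 1 − θ'`), which already implies the stuck stub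
with `c = θ (1 − θ')`. -/
def SliceAffinityHS : Prop :=
  ∃ θ θ' : ℝ, 1 / 2 < θ * (1 - θ') ∧ 0 ≤ θ' ∧ ∃ η₁ : ℝ, 0 < η₁ ∧ ∀ η : ℝ, 0 < η → η < η₁ →
    ∀ᶠ n : ℕ in atTop, ∃ δ : ℝ≥0∞, 0 < δ ∧ ∀ Ψ : TrialState (n + 1) (sideLength η (n + 1)),
      energy HS₁ Ψ ≤ groundStateEnergy HS₁ (n + 1) (sideLength η (n + 1)) + δ →
      (∀ X, Ψ.ψ X = (‖Ψ.ψ X‖ : ℂ)) →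
      ∃ G : Set (Config n), MeasurableSet G ∧
        ENNReal.ofReal (1 - θ') ≤ ∫⁻ Y in G, ENNReal.ofReal (∫ z, ‖Ψ.ψ (Matrix.vecCons z Y)‖ ^ 2) ∧
        ∀ Y ∈ G, θ * sideLength η (n + 1) ^ 3 * ∫ z, ‖Ψ.ψ (Matrix.vecCons z Y)‖ ^ 2 ≤
          (∫ z, ‖Ψ.ψ (Matrix.vecCons z Y)‖) ^ 2

end Summit.AtomisticToContinuum.BoseEinsteinCondensation.Cruxes.HardSphereBEC.StrategistCensus
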